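import Mathlib.RingTheory.Valuation.LocalSubring
import Mathlib.RingTheory.Valuation.ValuationSubring
import Mathlib.RingTheory.Localization.AtPrime.Basic
import HarnessLib

/-!
# Valuative divisibility on a model with prime special fibre

Topic: `Literature/AlgebraicGeometry/Resolution` (valued function fields; models over valuation
rings). A finite-level, purely algebraic form of the rigid-analytic principle "a function bounded
by `1` in sup-norm on an affinoid with reduced reduction lies in the unit ball of the model"
(Bosch–Güntzer–Remmert, *Non-Archimedean Analysis*, 6.4.3; used implicitly throughout §2.5–2.8 and
§3.3 of M. Temkin, *Inseparable local uniformization*, J. Algebra 373 (2013) =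
arXiv:0804.1554v3, e.g. "we can add to each `fⱼ` any element whose spectral norm is less than
`|π|`", proof of Lemma 3.3.2, and Thm. 2.8.2), in the form needed by the algebraic proof of
Thm. 3.3.1 of that paper (the algebraization of a common étale neighbourhood of a terminal point
of a curve over a valuation ring of height one):

on a ring `R` (an affine chart of a model) in which the pseudo-uniformizer `π` generates a PRIME
ideal (the special fibre is integral — for a smooth chart over a valuation ring this is arranged
by localizing at the point), divisibility by powers of `π`, and more generally by divisors `b`
of powers of `π`, is detected by ONE valuation `w` of `R` centred on `πR` (the "Gauss valuation"
of the chart: `w ≤ 1` on `R`, `w < 1` exactly on `πR`):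

* `dvd_pow_of_valuation_le_pow` — `w g ≤ (w π)ⁿ ⇒ πⁿ ∣ g` — PROVED (induction on `n`);
* `dvd_of_valuation_le` — for `b ∣ π^N` and `π` a non-zero-divisor, `w a ≤ w b ⇒ b ∣ a` — PROVED;
* `exists_valuationSubring_centre_eq` — **existence of the Gauss valuation**: for a subring `B`
  of a field `F` and a prime `Q` of `B` there is a valuation subring `W ⊇ B` of `F` with
  `W.valuation < 1` exactly on `Q` (Chevalley: `LocalSubring.exists_le_valuationSubring` applied
  to `B_Q`) — PROVED;
* `valuation_le_of_forms` — the comparison with the valuation `V` of the point: if `a = c_a u_a`,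
  `b = c_b u_b` with `u_a, u_b` of `w`-value `1` ("units at the point") and constants with
  `w c_a ≤ w c_b`, then `w a ≤ w b` — PROVED (trivial bookkeeping, recorded for the users).

All statements are [folklore]; no definitions, no named facts.

## Sources

* S. Bosch, U. Güntzer, R. Remmert, *Non-Archimedean Analysis*, Springer 1984, §6.4.3 (reduced
  affinoid algebras: power-bounded = integral), the analytic statement behind the lemma.
* M. Temkin, arXiv:0804.1554v3, proof of Lemma 3.3.2 (p. 46) and Thm. 2.8.2 (the uses).
-/

namespace Literature.AlgebraicGeometry.Resolution

/-! ### Divisibility by powers of `π` from one valuation centred on `πR` -/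

section Divisibility

variable {R : Type*} [CommRing R] {Γ₀ : Type*} [LinearOrderedCommGroupWithZero Γ₀]
  (w : Valuation R Γ₀) (π : R)

/-- **Valuative divisibility by powers of `π`.** If `w ≤ 1` on `R`, `w r < 1 ⇒ π ∣ r`
(the centre of `w` is contained in `πR`), `w π < 1` and `w π ≠ 0`, then
`w g ≤ (w π)ⁿ ⇒ πⁿ ∣ g`. [folklore] -/
theorem dvd_pow_of_valuation_le_pow (hle : ∀ r, w r ≤ 1) (hcentre : ∀ r, w r < 1 → π ∣ r)
    (hπlt : w π < 1) (hπ0 : w π ≠ 0) :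
    ∀ (n : ℕ) (g : R), w g ≤ w π ^ n → π ^ n ∣ g := by
  intro n
  induction n with
  | zero => intro g _; rw [pow_zero]; exact one_dvd g
  | succ n ih =>
    intro g hg
    -- `w g < 1`, so `π ∣ g`
    have hlt : w g < 1 := by
      refine lt_of_le_of_lt hg ?_
      calc w π ^ (n + 1) = w π ^ n * w π := pow_succ _ _
        _ ≤ 1 * w π := mul_le_mul' (pow_le_one' (hle π) n) le_rfl
        _ = w π := one_mul _
        _ < 1 := hπlt
    obtain ⟨g', rfl⟩ := hcentre g hlt
    -- cancel `w π`
    have hg' : w g' ≤ w π ^ n := by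
      rw [map_mul, pow_succ, mul_comm (w π ^ n)] at hg
      have h2 := mul_le_mul' (le_refl (w π)⁻¹) hg
      rwa [inv_mul_cancel_left₀ hπ0, inv_mul_cancel_left₀ hπ0] at h2
    obtain ⟨c, rfl⟩ := ih g' hg'
    exact ⟨c, by ring⟩

/-- **Valuative divisibility by a divisor of a power of `π`.** Under the same hypotheses, with `π`
a non-zero-divisor: if `b ∣ π^N` then `w a ≤ w b ⇒ b ∣ a`. [folklore] -/
theorem dvd_of_valuation_le (hle : ∀ r, w r ≤ 1) (hcentre : ∀ r, w r < 1 → π ∣ r)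
    (hπlt : w π < 1) (hπ0 : w π ≠ 0) (hπreg : π ∈ nonZeroDivisors R)
    {a b : R} {N : ℕ} (hb : b ∣ π ^ N) (hab : w a ≤ w b) : b ∣ a := by
  obtain ⟨b', hb'⟩ := hb
  -- `π^N ∣ a b'`
  have h1 : w (a * b') ≤ w π ^ N := by
    rw [map_mul, ← map_pow, hb', map_mul]
    exact mul_le_mul' hab le_rfl
  obtain ⟨c, hc⟩ := dvd_pow_of_valuation_le_pow w π hle hcentre hπlt hπ0 N (a * b') h1
  -- `a b' = π^N c = b b' c`, cancel the non-zero-divisor `b'`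
  refine ⟨c, ?_⟩
  have hb'reg : b' ∈ nonZeroDivisors R := by
    have hπN : π ^ N ∈ nonZeroDivisors R := pow_mem hπreg N
    rw [hb'] at hπN
    exact (mul_mem_nonZeroDivisors.mp hπN).2
  have : (a - b * c) * b' = 0 := by rw [sub_mul, mul_right_comm, ← hb', ← hc]; ring
  exact sub_eq_zero.mp ((mul_right_mem_nonZeroDivisors_eq_zero_iff hb'reg).mp this)

omit [LinearOrderedCommGroupWithZero Γ₀] in
/-- **Comparison bookkeeping**: products of a constant and a `w`-unit compare like their
constants. [folklore] -/
theorem valuation_le_of_forms {Γ₀ : Type*} [LinearOrderedCommGroupWithZero Γ₀] (w : Valuation R Γ₀)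
    {a b ca cb ua ub : R} (ha : a = ca * ua) (hb : b = cb * ub) (hua : w ua = 1) (hub : w ub = 1)
    (hc : w ca ≤ w cb) : w a ≤ w b := by
  rw [ha, hb, map_mul, map_mul, hua, hub, mul_one, mul_one]
  exact hc

end Divisibility

/-! ### Existence of the Gauss valuation: a valuation ring centred on a given prime -/

section Existence

variable {F : Type*} [Field F]

/-- **A valuation subring centred on a given prime** (Chevalley): for a subring `B` of a field
`F` and a prime ideal `Q` of `B`, there is a valuation subring `W` of `F` containing `B` whose
valuation is `< 1` on `B` exactly at the elements of `Q` (and `= 1` off `Q`). [folklore] -/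
theorem exists_valuationSubring_centre_eq (B : Subring F) (Q : Ideal B) [Q.IsPrime] :
    ∃ W : ValuationSubring F, B ≤ W.toSubring ∧
      (∀ b : B, b ∈ Q → W.valuation (b : F) < 1) ∧ (∀ b : B, b ∉ Q → W.valuation (b : F) = 1) := by
  obtain ⟨W, hW⟩ := (LocalSubring.ofPrime B Q).exists_le_valuationSubring
  obtain ⟨hBQW, hlocal⟩ := LocalSubring.le_def.mp hW
  have hBW : B ≤ W.toSubring := (LocalSubring.le_ofPrime B Q).trans hBQW
  refine ⟨W, hBW, fun b hb => ?_, fun b hb => ?_⟩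
  · have h1 : algebraMap B (LocalSubring.ofPrime B Q).toSubring b ∈
        IsLocalRing.maximalIdeal (LocalSubring.ofPrime B Q).toSubring :=
      (IsLocalization.AtPrime.to_map_mem_maximal_iff _ Q b).mpr hb
    have h2 : ¬ IsUnit (algebraMap B (LocalSubring.ofPrime B Q).toSubring b) := by
      rw [IsLocalRing.mem_maximalIdeal, mem_nonunits_iff] at h1
      exact h1
    have h3 : ¬ IsUnit (Subring.inclusion hBQW
        (algebraMap B (LocalSubring.ofPrime B Q).toSubring b)) :=
      fun hu => h2 (hlocal.map_nonunit _ hu)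
    have h4 : (⟨(b : F), hBW b.2⟩ : W) ∈ IsLocalRing.maximalIdeal W := by
      rw [IsLocalRing.mem_maximalIdeal, mem_nonunits_iff]
      exact h3
    exact (W.valuation_lt_one_iff _).mp h4
  · have h1 : IsUnit (algebraMap B (LocalSubring.ofPrime B Q).toSubring b) :=
      IsLocalization.map_units _ (⟨b, hb⟩ : Q.primeCompl)
    have h2 : IsUnit (Subring.inclusion hBQW (algebraMap B (LocalSubring.ofPrime B Q).toSubring b)) :=
      h1.map _
    have h3 : IsUnit (⟨(b : F), hBW b.2⟩ : W) := h2
    exact (W.valuation_eq_one_iff _).mp h3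

/-- **The Gauss valuation of a chart with prime special fibre**: for a subring `B` of a field `F`
and `π ∈ B` generating a prime ideal of `B`, there is a valuation subring `W ⊇ B` of `F` whose
valuation is `≤ 1` on `B`, `< 1` exactly on `πB`, with `W.valuation π < 1` and `≠ 0` (for
`π ≠ 0`) — the hypotheses of `dvd_pow_of_valuation_le_pow` for `W.valuation` restricted to `B`.
[folklore] -/
theorem exists_gaussValuation (B : Subring F) {π : B} (hπ : (Ideal.span {π} : Ideal B).IsPrime)
    (hπ0 : (π : F) ≠ 0) :
    ∃ W : ValuationSubring F, B ≤ W.toSubring ∧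
      (∀ b : B, W.valuation (b : F) ≤ 1) ∧ (∀ b : B, W.valuation (b : F) < 1 → π ∣ b) ∧
      W.valuation (π : F) < 1 ∧ W.valuation (π : F) ≠ 0 := by
  haveI := hπ
  obtain ⟨W, hBW, hlt, heq⟩ := exists_valuationSubring_centre_eq B (Ideal.span {π})
  refine ⟨W, hBW, fun b => W.valuation_le_one ⟨(b : F), hBW b.2⟩, fun b hb => ?_, ?_, ?_⟩
  · by_contra hnd
    have hb' : (b : B) ∉ Ideal.span {π} := fun h => hnd (Ideal.mem_span_singleton.mp h)
    rw [heq b hb'] at hb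
    exact lt_irrefl _ hb
  · exact hlt π (Ideal.mem_span_singleton_self π)
  · exact (Valuation.ne_zero_iff _).mpr hπ0

end Existence

end Literature.AlgebraicGeometry.Resolution
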